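import Mathlib
import Literature.NumberTheory.LFunctions.Zhang2022.Section17U021ChiR1Prelims
import Literature.NumberTheory.LFunctions.Zhang2022.Section17KappaTwoSums
import Literature.NumberTheory.LFunctions.Zhang2022.ToolkitDivisorMajorants
import Literature.NumberTheory.LFunctions.Zhang2022.TypedSection17NuStarBound
import Literature.NumberTheory.LFunctions.Zhang2022.Section15Bcoef
import Literature.NumberTheory.LFunctions.Zhang2022.Section17U007Bounds
import Literature.NumberTheory.LFunctions.Zhang2022.Section17U021ChiR1M1Sum
import Literature.NumberTheory.LFunctions.Zhang2022.Section7Eq75Majorants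
import Literature.NumberTheory.LFunctions.Zhang2022.Section10Theta1Evals
import Literature.NumberTheory.LFunctions.HallTenenbaumTheorem01
import HarnessLib

/-!
# Zhang (2022) §17.u021 (χ-twisted reading), remainder `R₁`: the COMPOSITE large-argument range
# (piece M2L-c of the lane's `R1Rel` cut) is negligible in the relative currency

Topic `Literature/NumberTheory/LFunctions/Zhang2022` (Landau–Siegel audit tree; verdict-neutral).
Y. Zhang, *Discrete mean estimates and the Landau–Siegel zero*, arXiv:2211.02515v1 (2022)
[Zhang2022LandauSiegel] — **an unrefereed manuscript under adjudication; nothing in this file asserts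
or denies its Theorems 1–2, and no claim about Landau–Siegel zeros is made.** ZHANG-L discharge lane,
WP16/§17, helper under the leaf `Typed.Section17.Eq17_9RelE e1ppD` via the sub-leaf `R₁` of
`Typed.Section17.Step17_u021Chi` (remainder of §17 p. 98, tex L4825: "we can drop the terms with
`m₂ > 1` … with an acceptable error" — no bound in print). In the owner's decomposition of `R₁`
(zl-libB-p6, `R1Rel`, consumer edge `Phi3Eval.eq17_9RelE_of_R1Rel`; node text R1-NODE.md) the
`m₂ ≥ 2` terms with LARGE argument `q₂m₂ > D⁴` split into PRIME `m₂` (piece M2L-p, window analysis) and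
COMPOSITE `m₂` (this file, piece M2L-c). What is PROVED here (theorems only, no definitions, no (A)-free
claim beyond what is stated):

* `sum_not_isPrimePow_div_le` — a GENERIC Hall–Tenenbaum-type tail: for `F ≥ 0` multiplicative on
  coprime arguments with `F 1 = 1` and local partial sums `Σ_{1≤k≤K}F(p^k)/p^k ≤ X(p)`,
  `Σ_{2≤m≤N, m not a prime power} F(m)/m ≤ (Σ_{p≤N}X(p))(exp Σ_{p≤N}X(p) − 1)` (split off the least
  prime power; `HallTenenbaum.sum_div_le_prod_tsum`);
* for the weight `F(m) = τ₄(m)|κ₂(m)|(m/φ(m))²` left after the `m₁`-sum (zl-w11-p3's `m1Sum_le`, M1,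
  with the factorisation `|κ̄₂(m₁m₂)| = |κ₂(m₂)|·∏_{p∣m₁,p∤m₂}|p^{−ib₁}−1|`): `Fkappa_local_le`,
  `sum_not_isPrimePow_Fkappa_le` (two distinct primes ⇒ DOUBLE gain `Y(e^Y − 1)`,
  `Y = 4C₄β(log N + log 4)`, `β ≥ |b₁| ≍ α`), `sum_isPrimePow_not_prime_Fkappa_le` (prime powers `p^k`,
  `k ≥ 2`: SINGLE gain `8C₄'C₅β`, size-independent);
* `inner_composite_le`, `outer_composite_le` — the `(m₁,m₂)`-sum at fixed `(l₁,l₂)` and the `l`-sum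
  against the weight `Σ_{l<D⁴}|ν(l)|τ₆(l)/l` (`|ν₁*| ≤ τ₄`, `τ₂ ∗ τ₄ = τ₆`);
* `R1_composite_large_small_of_count` — **M2L-c in the relative currency of the cut (ruling W16-S5f
  part 2 (B))**: GIVEN the `𝔞`-currency count `Σ_{l<D⁴}|ν(l)|τ₆(l)/l ≤ C(𝔞+1)³` (piece A1b, hypothesis
  `hcount`), for every `ε > 0`, eventually in `D`, under (A),
  `Σ_{l<D⁴}|ν(l)|/l Σ_{l=l₁l₂} Σ'_{m₁} Σ'_{m₂ : D⁴<l₂m₂, 2≤m₂, m₂ not prime, (m₂,l₁)=1}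
   |b(l₁m₁)||ν₁*(l₂m₂)||κ̄₂(m₁m₂)|/(m₁m₂) ≤ ε(𝔞+1)`
  (`|b₁| ≤ (1+5|c′|π)α`, `α = π𝓛⁻⁹`, `𝔞 ≤ 16e⁹𝓛⁴`: total `≪ 𝓛⁻¹(𝔞+1)`). The prime-power corner
  (`m₂ = 4, 8, 9, …` with `l₂ > D⁴/m₂`) carries only the single gain `≍ α` against an outer count of size
  `(𝔞+1)³`, which is why the piece is stated relatively and under (A) (sizing on HOME/STATUS 02:39Z).

## References

* Y. Zhang, arXiv:2211.02515v1 (2022), §17 p. 98 (u021), tex L4825; App. A p. 105 (`κ₂(q^r)`).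
  [cite: Zhang2022LandauSiegel, §17 u021 p.98]
* R. R. Hall, G. Tenenbaum, *Divisors* (1988), (0.4). [cite: HallTenenbaum1988, (0.4)]
-/

noncomputable section

open Complex Real ComplexConjugate ArithmeticFunction Finset
open scoped LSeries.notation

namespace Literature.NumberTheory.LFunctions.Zhang2022.Typed.Section17

open Literature.NumberTheory.LFunctions.Zhang2022
open Literature.NumberTheory.LFunctions.Zhang2022.Skeleton
open Literature.NumberTheory.LFunctions.Zhang2022.MeanSquareMajorant

/-! ## §1. Pointwise majorants -/

section Pointwise

variable (c' : ℝ) {D : ℕ} (χ : DirichletCharacter ℂ D)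

/-- **`|ν₁*(n)| ≤ τ₄(n)`** (`ν₁* = υ·[≤D⁴] ∗ nN_{β₂} ∗ nN_{β₃}`, `|υ| ≤ τ₂`, `|nN| ≤ 1`; `𝓛 > 0`).
[cite: Zhang2022LandauSiegel, §17 u014 p.97] -/
theorem norm_nuOneStar_le_tau_four (hℓ : 0 < ell D) (n : ℕ) : ‖nuOneStar c' χ n‖ ≤ tau 4 n := by
  have hconv : ∀ (u v : ℕ → ℂ) (m : ℕ), (u ⍟ v) m = seqConv u v m := fun u v m => by
    rw [LSeries.convolution_def]; rfl
  have hβ2 : (beta2 c' D).re = 0 := by simp [beta2]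
  have hβ3 : (beta3 c' D).re = 0 := by simp [beta3]
  have h3 : ∀ m, m ≠ 0 → ‖(trunc (D ^ 4) (ups χ) ⍟ nN D (beta2 c' D)) m‖ ≤ 1 * 1 * tau (2 + 1) m := by
    intro m _
    rw [hconv]
    exact norm_seqConv_le_tau zero_le_one (fun m _ => by rw [one_mul]; exact norm_trunc_ups_le χ m)
      (fun m hm => by rw [tau_one_apply hm, mul_one]; exact Phi3Eval.norm_nN_le_one hℓ hβ2 m) m
  have h4 : ∀ m, m ≠ 0 → ‖nuOneStar c' χ m‖ ≤ 1 * 1 * 1 * tau (2 + 1 + 1) m := by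
    intro m _
    rw [nuOneStar, hconv]
    exact norm_seqConv_le_tau (by norm_num) h3
      (fun m hm => by rw [tau_one_apply hm, mul_one]; exact Phi3Eval.norm_nN_le_one hℓ hβ3 m) m
  rcases Nat.eq_zero_or_pos n with rfl | hn
  · simp [nuOneStar, LSeries.convolution_map_zero]
  refine (h4 n hn.ne').trans (le_of_eq ?_)
  norm_num

/-- `‖κ̄₂(m₁m₂)‖ ≤ ‖κ₂(m₂)‖·∏_{p ∣ m₁, p ∤ m₂}|p^{−ib₁} − 1|` — the exact splitting of the `κ`-gain
(`Typed.Section17.norm_kappa₂_mul_eq`), stated for `kappa2bar`. [cite: Zhang2022LandauSiegel, §17 u021 p.98] -/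
theorem norm_kappa2bar_mul_eq_split {m₁ m₂ : ℕ} (hm₁ : m₁ ≠ 0) (hm₂ : m₂ ≠ 0) :
    ‖kappa2bar c' D (m₁ * m₂)‖ =
      ‖kappa₂ (b1 c' D) m₂‖ * ∏ q ∈ m₁.primeFactors \ m₂.primeFactors, ‖powI (b1 c' D) q - 1‖ := by
  rw [norm_kappa2bar_eq c' D, mul_comm m₁ m₂, norm_kappa₂_mul_eq (b1 c' D) hm₂ hm₁]

end Pointwise

/-! ## §3. The engine: multiplicative majorants over `m₂` with at least two distinct primes -/

section OmegaTwo

variable {F : ℕ → ℝ}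

/-- Partial sums of a nonnegative local series bounded by `X p` give a summable local series with sum
`≤ 1 + X p` (the `ν = 0` term is `F(1) = 1`). [folklore] -/
private theorem local_tsum_le (hf1 : F 1 = 1) (hf0 : ∀ n, 0 ≤ F n) (p : ℕ) {Xp : ℝ}
    (hpart : ∀ K : ℕ, ∑ k ∈ Icc 1 K, F (p ^ k) / (p : ℝ) ^ k ≤ Xp) :
    Summable (fun ν : ℕ => F (p ^ ν) / (p : ℝ) ^ ν) ∧
      ∑' ν : ℕ, F (p ^ ν) / (p : ℝ) ^ ν ≤ 1 + Xp := by
  have hg0 : ∀ ν, 0 ≤ F (p ^ ν) / (p : ℝ) ^ ν := fun ν => div_nonneg (hf0 _) (by positivity)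
  -- partial sums over `range n` are `≤ 1 + Xp`
  have hrange : ∀ n, ∑ ν ∈ Finset.range n, F (p ^ ν) / (p : ℝ) ^ ν ≤ 1 + Xp := by
    intro n
    rcases Nat.eq_zero_or_pos n with rfl | hn
    · simp only [Finset.range_zero, Finset.sum_empty]
      have := hpart 0
      simp at this
      linarith
    rw [Finset.range_eq_Ico, Finset.sum_eq_sum_Ico_succ_bot hn, pow_zero, pow_zero, hf1, div_one]
    have hsub : ∑ ν ∈ Finset.Ico 1 n, F (p ^ ν) / (p : ℝ) ^ ν ≤ Xp := by
      have h1 : Finset.Ico 1 n = Icc 1 (n - 1) := by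
        ext k; simp only [Finset.mem_Ico, Finset.mem_Icc]; omega
      rw [h1]; exact hpart (n - 1)
    linarith
  have hsum : Summable (fun ν : ℕ => F (p ^ ν) / (p : ℝ) ^ ν) :=
    summable_of_sum_range_le hg0 hrange
  exact ⟨hsum, hsum.tsum_le_of_sum_range_le hrange⟩

/-- **The `ω ≥ 2` tail of an Euler-type majorant.** Let `F ≥ 0` be multiplicative on coprime
arguments with `F 1 = 1`, and suppose that at every prime `p` the partial sums of the local series are
bounded: `Σ_{1≤k≤K} F(p^k)/p^k ≤ X(p)` (`X ≥ 0`). Then for every `N`,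
`Σ_{2≤m≤N, m not a prime power} F(m)/m ≤ (Σ_{p≤N} X(p))·(exp(Σ_{p≤N} X(p)) − 1)`:
write `m = p^k·m′` with `p` the least prime factor (`m′ ≥ 2` coprime to `p`), bound the sum over the
pairs `(p^k, m′)` by the product of `Σ_{p^k≤N} F(p^k)/p^k ≤ Σ_p X(p)` and
`Σ_{2≤m′≤N} F(m′)/m′ ≤ ∏_{p≤N}(1 + X(p)) − 1` (Hall–Tenenbaum (0.4), `HallTenenbaum.sum_div_le_prod_tsum`).
[cite: HallTenenbaum1988, (0.4)] -/
theorem sum_not_isPrimePow_div_le (hf1 : F 1 = 1)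
    (hmul : ∀ m n : ℕ, Nat.Coprime m n → F (m * n) = F m * F n) (hf0 : ∀ n, 0 ≤ F n)
    {X : ℕ → ℝ} (hX0 : ∀ p, 0 ≤ X p)
    (hpart : ∀ p : ℕ, p.Prime → ∀ K : ℕ, ∑ k ∈ Icc 1 K, F (p ^ k) / (p : ℝ) ^ k ≤ X p) (N : ℕ) :
    ∑ m ∈ (Icc 2 N).filter (fun m => ¬ IsPrimePow m), F m / m ≤
      (∑ p ∈ Nat.primesLE N, X p) * (Real.exp (∑ p ∈ Nat.primesLE N, X p) - 1) := by
  classical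
  set S := (Icc 2 N).filter (fun m => ¬ IsPrimePow m) with hS
  set A := (Icc 2 N).filter (fun m => IsPrimePow m) with hA
  set B := Icc 2 N with hB
  set g : ℕ → ℝ := fun n => F n / n with hg
  have hg0 : ∀ n, 0 ≤ g n := fun n => div_nonneg (hf0 n) (Nat.cast_nonneg n)
  -- the splitting map `m ↦ (ordProj[minFac m] m, ordCompl[minFac m] m)`
  set ι : ℕ → ℕ × ℕ := fun m => (ordProj[m.minFac] m, ordCompl[m.minFac] m) with hι
  have hιmul : ∀ m, (ι m).1 * (ι m).2 = m := fun m => Nat.ordProj_mul_ordCompl_eq_self m _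
  have hfacts : ∀ m ∈ S, (ι m).1 ∈ A ∧ (ι m).2 ∈ B ∧ Nat.Coprime (ι m).1 (ι m).2 := by
    intro m hm
    rw [hS, Finset.mem_filter, Finset.mem_Icc] at hm
    obtain ⟨⟨hm2, hmN⟩, hnp⟩ := hm
    have hm0 : m ≠ 0 := by omega
    have hm1 : m ≠ 1 := by omega
    have hp : m.minFac.Prime := Nat.minFac_prime hm1
    have hpm : m.minFac ∣ m := Nat.minFac_dvd m
    have hk : 0 < m.factorization m.minFac := Nat.Prime.factorization_pos_of_dvd hp hm0 hpm
    have hcop : Nat.Coprime (ι m).1 (ι m).2 := (Nat.coprime_ordCompl hp hm0).pow_left _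
    have h1le : (ι m).1 ≤ m := Nat.le_of_dvd (by omega) (Nat.ordProj_dvd m _)
    have h2le : (ι m).2 ≤ m := Nat.le_of_dvd (by omega) (Nat.ordCompl_dvd m _)
    have h2pos : 0 < (ι m).2 := Nat.ordCompl_pos _ hm0
    have h2ne1 : (ι m).2 ≠ 1 := by
      intro h1
      apply hnp
      have : m = m.minFac ^ m.factorization m.minFac := by
        have := hιmul m
        rw [h1, mul_one] at this
        exact this.symm
      rw [this]
      exact (hp.prime.isPrimePow).pow hk.ne'
    refine ⟨?_, ?_, hcop⟩
    · rw [hA, Finset.mem_filter, Finset.mem_Icc]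
      refine ⟨⟨?_, h1le.trans hmN⟩, (hp.prime.isPrimePow).pow hk.ne'⟩
      calc 2 ≤ m.minFac := hp.two_le
        _ = m.minFac ^ 1 := (pow_one _).symm
        _ ≤ m.minFac ^ m.factorization m.minFac := Nat.pow_le_pow_right hp.pos hk
    · rw [hB, Finset.mem_Icc]; exact ⟨by omega, h2le.trans hmN⟩
  have hinj : Set.InjOn ι S := by
    intro m _ m' _ h
    rw [← hιmul m, ← hιmul m', h]
  -- each term factors
  have hterm : ∀ m ∈ S, g m = g (ι m).1 * g (ι m).2 := by
    intro m hm
    obtain ⟨-, -, hcop⟩ := hfacts m hm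
    simp only [hg]
    conv_lhs => rw [← hιmul m]
    rw [hmul _ _ hcop]; push_cast; ring
  -- sum over S ≤ (Σ_A g)(Σ_B g)
  have hstep : ∑ m ∈ S, g m ≤ (∑ x ∈ A, g x) * (∑ y ∈ B, g y) := by
    calc ∑ m ∈ S, g m = ∑ m ∈ S, g (ι m).1 * g (ι m).2 := Finset.sum_congr rfl hterm
      _ = ∑ z ∈ S.image ι, g z.1 * g z.2 :=
          (Finset.sum_image (f := fun z : ℕ × ℕ => g z.1 * g z.2) hinj).symm
      _ ≤ ∑ z ∈ A ×ˢ B, g z.1 * g z.2 := by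
          refine Finset.sum_le_sum_of_subset_of_nonneg ?_ (fun z _ _ => mul_nonneg (hg0 _) (hg0 _))
          intro z hz
          rw [Finset.mem_image] at hz
          obtain ⟨m, hm, rfl⟩ := hz
          obtain ⟨h1, h2, -⟩ := hfacts m hm
          exact Finset.mem_product.mpr ⟨h1, h2⟩
      _ = (∑ x ∈ A, g x) * (∑ y ∈ B, g y) := by rw [Finset.sum_product, Finset.sum_mul_sum]
  -- Σ_A g ≤ Σ_p X p : reindex prime powers by (p, k)
  have hA_le : ∑ x ∈ A, g x ≤ ∑ p ∈ Nat.primesLE N, X p := by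
    set K₀ := Nat.log 2 N with hK₀
    have hcover : A ⊆ (Nat.primesLE N ×ˢ Icc 1 K₀).image (fun z => z.1 ^ z.2) := by
      intro x hx
      rw [hA, Finset.mem_filter, Finset.mem_Icc] at hx
      obtain ⟨⟨hx2, hxN⟩, hpp⟩ := hx
      rw [isPrimePow_nat_iff] at hpp
      obtain ⟨p, k, hp, hk, rfl⟩ := hpp
      rw [Finset.mem_image]
      refine ⟨(p, k), Finset.mem_product.mpr ⟨?_, ?_⟩, rfl⟩
      · rw [Nat.mem_primesLE]
        exact ⟨le_trans (Nat.le_self_pow hk.ne' p) hxN, hp⟩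
      · rw [Finset.mem_Icc]
        refine ⟨hk, ?_⟩
        rw [hK₀]
        calc k ≤ Nat.log p (p ^ k) := by rw [Nat.log_pow hp.one_lt]
          _ ≤ Nat.log 2 (p ^ k) := Nat.log_anti_left (by norm_num) hp.two_le
          _ ≤ Nat.log 2 N := Nat.log_mono_right hxN
    calc ∑ x ∈ A, g x ≤ ∑ x ∈ (Nat.primesLE N ×ˢ Icc 1 K₀).image (fun z => z.1 ^ z.2), g x :=
          Finset.sum_le_sum_of_subset_of_nonneg hcover fun x _ _ => hg0 x
      _ ≤ ∑ z ∈ Nat.primesLE N ×ˢ Icc 1 K₀, g (z.1 ^ z.2) :=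
          Finset.sum_image_le_of_nonneg fun z _ => hg0 _
      _ = ∑ p ∈ Nat.primesLE N, ∑ k ∈ Icc 1 K₀, F (p ^ k) / (p : ℝ) ^ k := by
          rw [Finset.sum_product]
          refine Finset.sum_congr rfl fun p _ => Finset.sum_congr rfl fun k _ => ?_
          simp only [hg]; push_cast; rfl
      _ ≤ ∑ p ∈ Nat.primesLE N, X p :=
          Finset.sum_le_sum fun p hp => hpart p (Nat.mem_primesLE.1 hp).2 K₀
  -- Σ_B g ≤ exp(Σ X) − 1
  have hXsum0 : 0 ≤ ∑ p ∈ Nat.primesLE N, X p := Finset.sum_nonneg fun p _ => hX0 p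
  have hB_le : ∑ y ∈ B, g y ≤ Real.exp (∑ p ∈ Nat.primesLE N, X p) - 1 := by
    rcases Nat.eq_zero_or_pos N with hN0 | hN
    · have hBe : B = ∅ := by rw [hB, hN0]; rfl
      rw [hBe, Finset.sum_empty]
      have := Real.one_le_exp hXsum0
      linarith
    have hsplit : ∑ y ∈ Icc 1 N, g y = g 1 + ∑ y ∈ B, g y := by
      rw [hB]
      have : Icc 1 N = insert 1 (Icc 2 N) := by
        ext y; simp only [Finset.mem_insert, Finset.mem_Icc]; omega
      rw [this, Finset.sum_insert (by simp)]
    have hg1 : g 1 = 1 := by simp [hg, hf1]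
    have hloc : ∀ p : ℕ, p.Prime →
        Summable (fun ν : ℕ => F (p ^ ν) / (p : ℝ) ^ ν) ∧ ∑' ν : ℕ, F (p ^ ν) / (p : ℝ) ^ ν ≤ 1 + X p :=
      fun p hp => local_tsum_le hf1 hf0 p (hpart p hp)
    have hHT := HallTenenbaum.sum_div_le_prod_tsum hf1 hmul hf0 (fun p hp => (hloc p hp).1) N
    have hprod : ∏ p ∈ Nat.primesLE N, ∑' ν : ℕ, F (p ^ ν) / (p : ℝ) ^ ν ≤
        ∏ p ∈ Nat.primesLE N, Real.exp (X p) := by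
      refine Finset.prod_le_prod (fun p _ => tsum_nonneg fun ν => div_nonneg (hf0 _) (by positivity))
        fun p hp => ?_
      have hp' := (Nat.mem_primesLE.1 hp).2
      calc ∑' ν : ℕ, F (p ^ ν) / (p : ℝ) ^ ν ≤ 1 + X p := (hloc p hp').2
        _ ≤ Real.exp (X p) := by have := Real.add_one_le_exp (X p); linarith
    rw [← Real.exp_sum] at hprod
    have : ∑ y ∈ Icc 1 N, g y = ∑ n ∈ Icc 1 N, F n / n := rfl
    linarith [hHT]
  -- combine
  calc ∑ m ∈ S, F m / m = ∑ m ∈ S, g m := rfl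
    _ ≤ (∑ x ∈ A, g x) * (∑ y ∈ B, g y) := hstep
    _ ≤ (∑ p ∈ Nat.primesLE N, X p) * (Real.exp (∑ p ∈ Nat.primesLE N, X p) - 1) :=
        mul_le_mul hA_le hB_le (Finset.sum_nonneg fun y _ => hg0 y) hXsum0

end OmegaTwo


/-! ## §4. The concrete majorant `F(m) = τ₄(m)·|κ₂(m)|·(m/φ(m))²` -/

section Concrete

/-- The numerical constant `C₄ = Σ_{i≥0} (i+2)⁴ 2^{−i}` (finite). [folklore] -/
private theorem summable_C4 : Summable (fun i : ℕ => ((i : ℝ) + 2) ^ 4 * (1 / 2 : ℝ) ^ i) := by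
  have h : Summable (fun i : ℕ => ((i : ℝ) ^ 4 : ℝ) * (1 / 2 : ℝ) ^ i) :=
    summable_pow_mul_geometric_of_norm_lt_one 4 (by norm_num)
  -- `(i+2)^4 ≤ 16·(i^4 + 1)`... use the shifted series instead: `(i+2)^4 (1/2)^i = 4 · (i+2)^4 (1/2)^(i+2)`
  have h2 : Summable (fun i : ℕ => (((i + 2 : ℕ) : ℝ) ^ 4) * (1 / 2 : ℝ) ^ (i + 2)) :=
    (summable_nat_add_iff 2).mpr h
  have h3 : Summable (fun i : ℕ => 4 * ((((i + 2 : ℕ) : ℝ) ^ 4) * (1 / 2 : ℝ) ^ (i + 2))) := h2.mul_left 4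
  refine h3.congr fun i => ?_
  push_cast
  ring

/-- The numerical constant `C₄' = Σ_{i≥0} (i+3)⁴ 2^{−i}` (finite). [folklore] -/
private theorem summable_C4' : Summable (fun i : ℕ => ((i : ℝ) + 3) ^ 4 * (1 / 2 : ℝ) ^ i) := by
  have h : Summable (fun i : ℕ => ((i : ℝ) ^ 4 : ℝ) * (1 / 2 : ℝ) ^ i) :=
    summable_pow_mul_geometric_of_norm_lt_one 4 (by norm_num)
  have h2 : Summable (fun i : ℕ => (((i + 3 : ℕ) : ℝ) ^ 4) * (1 / 2 : ℝ) ^ (i + 3)) :=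
    (summable_nat_add_iff 3).mpr h
  have h3 : Summable (fun i : ℕ => 8 * ((((i + 3 : ℕ) : ℝ) ^ 4) * (1 / 2 : ℝ) ^ (i + 3))) := h2.mul_left 8
  refine h3.congr fun i => ?_
  push_cast
  ring

/-- `Σ_{1≤k≤K} (k+1)⁴/p^k ≤ C₄/p` for `p ≥ 2` (`p^k ≥ p·2^{k−1}`). [folklore] -/
private theorem sum_pow_four_div_pow_le {p : ℕ} (hp : 2 ≤ p) (K : ℕ) :
    ∑ k ∈ Icc 1 K, ((k : ℝ) + 1) ^ 4 / (p : ℝ) ^ k ≤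
      (∑' i : ℕ, ((i : ℝ) + 2) ^ 4 * (1 / 2 : ℝ) ^ i) / (p : ℝ) := by
  have hp0 : (0 : ℝ) < p := by exact_mod_cast (by omega : 0 < p)
  have hp2 : (2 : ℝ) ≤ p := by exact_mod_cast hp
  -- termwise: `(k+1)^4/p^k ≤ ((k-1)+2)^4 (1/2)^(k-1) / p`
  have hterm : ∀ k ∈ Icc 1 K, ((k : ℝ) + 1) ^ 4 / (p : ℝ) ^ k ≤
      ((((k - 1 : ℕ) : ℝ) + 2) ^ 4 * (1 / 2 : ℝ) ^ (k - 1)) / (p : ℝ) := by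
    intro k hk
    obtain ⟨hk1, -⟩ := Finset.mem_Icc.mp hk
    have hk' : ((k - 1 : ℕ) : ℝ) + 2 = (k : ℝ) + 1 := by
      rw [Nat.cast_sub hk1]; push_cast; ring
    rw [hk', div_le_div_iff₀ (by positivity) hp0]
    -- goal: (k+1)^4 * p ≤ (k+1)^4 * (1/2)^(k-1) * p^k
    have hpk : (p : ℝ) ≤ (1 / 2 : ℝ) ^ (k - 1) * (p : ℝ) ^ k := by
      have : (p : ℝ) ^ k = p * (p : ℝ) ^ (k - 1) := by
        rw [← pow_succ']; congr 1; omega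
      rw [this, ← mul_assoc, mul_comm ((1/2 : ℝ) ^ (k-1)), mul_assoc, ← mul_pow]
      have h1 : (1 : ℝ) ≤ (1 / 2 * p) ^ (k - 1) := one_le_pow₀ (by linarith)
      nlinarith
    have h0 : 0 ≤ ((k : ℝ) + 1) ^ 4 := by positivity
    calc ((k : ℝ) + 1) ^ 4 * p ≤ ((k : ℝ) + 1) ^ 4 * ((1 / 2 : ℝ) ^ (k - 1) * (p : ℝ) ^ k) :=
          mul_le_mul_of_nonneg_left hpk h0
      _ = ((k : ℝ) + 1) ^ 4 * (1 / 2 : ℝ) ^ (k - 1) * (p : ℝ) ^ k := by ring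
  refine (Finset.sum_le_sum hterm).trans ?_
  rw [← Finset.sum_div]
  refine div_le_div_of_nonneg_right ?_ hp0.le
  -- reindex `k - 1 = i` and compare with the tsum
  have hre : ∑ k ∈ Icc 1 K, (((k - 1 : ℕ) : ℝ) + 2) ^ 4 * (1 / 2 : ℝ) ^ (k - 1) =
      ∑ i ∈ Finset.range K, ((i : ℝ) + 2) ^ 4 * (1 / 2 : ℝ) ^ i := by
    have : Icc 1 K = (Finset.range K).image (· + 1) := by
      ext k; simp only [Finset.mem_Icc, Finset.mem_image, Finset.mem_range]; constructor
      · intro h; exact ⟨k - 1, by omega, by omega⟩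
      · rintro ⟨i, hi, rfl⟩; omega
    rw [this, Finset.sum_image (fun a _ b _ h => by omega)]
    refine Finset.sum_congr rfl fun i _ => ?_
    simp
  rw [hre]
  exact summable_C4.sum_le_tsum _ (fun i _ => by positivity)

/-- `Σ_{2≤k≤K} (k+1)⁴/p^k ≤ C₄'/p²` for `p ≥ 2`. [folklore] -/
private theorem sum_pow_four_div_pow_le_two {p : ℕ} (hp : 2 ≤ p) (K : ℕ) :
    ∑ k ∈ Icc 2 K, ((k : ℝ) + 1) ^ 4 / (p : ℝ) ^ k ≤
      (∑' i : ℕ, ((i : ℝ) + 3) ^ 4 * (1 / 2 : ℝ) ^ i) / (p : ℝ) ^ 2 := by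
  have hp0 : (0 : ℝ) < p := by exact_mod_cast (by omega : 0 < p)
  have hp2 : (2 : ℝ) ≤ p := by exact_mod_cast hp
  have hterm : ∀ k ∈ Icc 2 K, ((k : ℝ) + 1) ^ 4 / (p : ℝ) ^ k ≤
      ((((k - 2 : ℕ) : ℝ) + 3) ^ 4 * (1 / 2 : ℝ) ^ (k - 2)) / (p : ℝ) ^ 2 := by
    intro k hk
    obtain ⟨hk2, -⟩ := Finset.mem_Icc.mp hk
    have hk' : ((k - 2 : ℕ) : ℝ) + 3 = (k : ℝ) + 1 := by
      rw [Nat.cast_sub hk2]; push_cast; ring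
    rw [hk', div_le_div_iff₀ (by positivity) (by positivity)]
    have hpk : (p : ℝ) ^ 2 ≤ (1 / 2 : ℝ) ^ (k - 2) * (p : ℝ) ^ k := by
      have : (p : ℝ) ^ k = (p : ℝ) ^ 2 * (p : ℝ) ^ (k - 2) := by
        rw [← pow_add]; congr 1; omega
      rw [this, ← mul_assoc, mul_comm ((1/2 : ℝ) ^ (k-2)), mul_assoc, ← mul_pow]
      have h1 : (1 : ℝ) ≤ (1 / 2 * p) ^ (k - 2) := one_le_pow₀ (by linarith)
      nlinarith [pow_pos hp0 2]
    have h0 : 0 ≤ ((k : ℝ) + 1) ^ 4 := by positivity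
    calc ((k : ℝ) + 1) ^ 4 * (p : ℝ) ^ 2 ≤ ((k : ℝ) + 1) ^ 4 * ((1 / 2 : ℝ) ^ (k - 2) * (p : ℝ) ^ k) :=
          mul_le_mul_of_nonneg_left hpk h0
      _ = ((k : ℝ) + 1) ^ 4 * (1 / 2 : ℝ) ^ (k - 2) * (p : ℝ) ^ k := by ring
  refine (Finset.sum_le_sum hterm).trans ?_
  rw [← Finset.sum_div]
  refine div_le_div_of_nonneg_right ?_ (by positivity)
  have hre : ∑ k ∈ Icc 2 K, (((k - 2 : ℕ) : ℝ) + 3) ^ 4 * (1 / 2 : ℝ) ^ (k - 2) =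
      ∑ i ∈ Finset.range (K - 1), ((i : ℝ) + 3) ^ 4 * (1 / 2 : ℝ) ^ i := by
    have : Icc 2 K = (Finset.range (K - 1)).image (· + 2) := by
      ext k; simp only [Finset.mem_Icc, Finset.mem_image, Finset.mem_range]; constructor
      · intro h; exact ⟨k - 2, by omega, by omega⟩
      · rintro ⟨i, hi, rfl⟩; omega
    rw [this, Finset.sum_image (fun a _ b _ h => by omega)]
    refine Finset.sum_congr rfl fun i _ => ?_
    simp
  rw [hre]
  exact summable_C4'.sum_le_tsum _ (fun i _ => by positivity)

/-- `(m/φ(m))²` is multiplicative on coprime arguments. [folklore] -/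
private theorem ratio_totient_sq_mul {m n : ℕ} (hmn : Nat.Coprime m n) :
    (((m * n : ℕ) : ℝ) / Nat.totient (m * n)) ^ 2 =
      ((m : ℝ) / Nat.totient m) ^ 2 * ((n : ℝ) / Nat.totient n) ^ 2 := by
  rw [Nat.totient_mul hmn]; push_cast
  rw [mul_div_mul_comm, mul_pow]

/-- `(p^k/φ(p^k))² ≤ 4` for a prime `p` (`p/(p−1) ≤ 2`). [folklore] -/
private theorem ratio_totient_sq_prime_pow_le {p : ℕ} (hp : p.Prime) (k : ℕ) :
    (((p ^ k : ℕ) : ℝ) / Nat.totient (p ^ k)) ^ 2 ≤ 4 := by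
  rcases Nat.eq_zero_or_pos k with rfl | hk
  · simp
  have hφ := Nat.totient_prime_pow hp hk
  have hp2 : 2 ≤ p := hp.two_le
  have hφpos : 0 < Nat.totient (p ^ k) := Nat.totient_pos.mpr (pow_pos hp.pos k)
  have hratio : ((p ^ k : ℕ) : ℝ) / Nat.totient (p ^ k) ≤ 2 := by
    rw [div_le_iff₀ (by exact_mod_cast hφpos), hφ]
    have h1 : p ^ k = p ^ (k - 1) * p := by rw [← pow_succ]; congr 1; omega
    rw [h1]; push_cast
    rw [Nat.cast_sub (by omega)]; push_cast
    have hpk : (0 : ℝ) ≤ (p : ℝ) ^ (k - 1) := by positivity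
    have hp2' : (2 : ℝ) ≤ p := by exact_mod_cast hp2
    nlinarith
  have h0 : 0 ≤ ((p ^ k : ℕ) : ℝ) / Nat.totient (p ^ k) := by positivity
  nlinarith

end Concrete


/-! ## §5. The two `m₂`-sums for `F(m) = τ₄(m)·|κ₂(m)|·(m/φ(m))²` -/

section MTwoSums

/-- `F(m) = τ₄(m)|κ₂(m)|(m/φ(m))²` is `1` at `1`, nonnegative, and multiplicative on coprime arguments.
[folklore] -/
private theorem Fkappa_basic (b : ℝ) :
    (tau 4 1 * ‖kappa₂ b 1‖ * (((1 : ℕ) : ℝ) / Nat.totient 1) ^ 2 = 1) ∧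
    (∀ n : ℕ, 0 ≤ tau 4 n * ‖kappa₂ b n‖ * ((n : ℝ) / Nat.totient n) ^ 2) ∧
    (∀ m n : ℕ, Nat.Coprime m n →
      tau 4 (m * n) * ‖kappa₂ b (m * n)‖ * (((m * n : ℕ) : ℝ) / Nat.totient (m * n)) ^ 2 =
        (tau 4 m * ‖kappa₂ b m‖ * ((m : ℝ) / Nat.totient m) ^ 2) *
          (tau 4 n * ‖kappa₂ b n‖ * ((n : ℝ) / Nat.totient n) ^ 2)) := by
  refine ⟨?_, fun n => mul_nonneg (mul_nonneg (tau_nonneg 4 n) (norm_nonneg _)) (sq_nonneg _),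
    fun m n hmn => ?_⟩
  · rw [tau_apply_one, AppendixA.kappa₂_apply_one]; simp
  · rw [(isMultiplicative_tau 4).map_mul_of_coprime hmn, (isMultiplicative_kappa₂ b).map_mul_of_coprime hmn,
      norm_mul, ratio_totient_sq_mul hmn]
    ring

/-- **Local partial sums of `F`**: for a prime `p`, every `K`, and any `C₄ ≥ Σ_i (i+2)⁴2^{−i}`,
`Σ_{1≤k≤K} F(p^k)/p^k ≤ 4C₄·|b|·log p / p` (`|κ₂(p^k)| ≤ |b| log p`, `τ₄(p^k) ≤ (k+1)⁴`, `(p/(p−1))² ≤ 4`,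
`Σ_k (k+1)⁴/p^k ≤ C₄/p`). [cite: Zhang2022LandauSiegel, App. A p. 105] -/
theorem Fkappa_local_le (b : ℝ) {C4 : ℝ} (hC4 : ∑' i : ℕ, ((i : ℝ) + 2) ^ 4 * (1 / 2 : ℝ) ^ i ≤ C4)
    {p : ℕ} (hp : p.Prime) (K : ℕ) :
    ∑ k ∈ Icc 1 K, tau 4 (p ^ k) * ‖kappa₂ b (p ^ k)‖ * (((p ^ k : ℕ) : ℝ) / Nat.totient (p ^ k)) ^ 2 /
        (p : ℝ) ^ k ≤ 4 * C4 * (|b| * Real.log p) / p := by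
  have hp0 : (0 : ℝ) < p := by exact_mod_cast hp.pos
  have hlog0 : 0 ≤ |b| * Real.log p := mul_nonneg (abs_nonneg b) (Real.log_natCast_nonneg p)
  have hterm : ∀ k ∈ Icc 1 K,
      tau 4 (p ^ k) * ‖kappa₂ b (p ^ k)‖ * (((p ^ k : ℕ) : ℝ) / Nat.totient (p ^ k)) ^ 2 / (p : ℝ) ^ k ≤
        4 * (|b| * Real.log p) * (((k : ℝ) + 1) ^ 4 / (p : ℝ) ^ k) := by
    intro k hk
    obtain ⟨hk1, -⟩ := Finset.mem_Icc.mp hk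
    obtain ⟨j, rfl⟩ : ∃ j, k = j + 1 := ⟨k - 1, by omega⟩
    have h1 : tau 4 (p ^ (j + 1)) ≤ (((j + 1 : ℕ) : ℝ) + 1) ^ 4 := by
      have := tau_prime_pow_le 4 hp (j + 1); push_cast at this ⊢; exact this
    have h2 : ‖kappa₂ b (p ^ (j + 1))‖ ≤ |b| * Real.log p := AppendixA.norm_kappa₂_prime_pow_succ_le b hp j
    have h3 : (((p ^ (j + 1) : ℕ) : ℝ) / Nat.totient (p ^ (j + 1))) ^ 2 ≤ 4 :=
      ratio_totient_sq_prime_pow_le hp (j + 1)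
    have hpk : (0 : ℝ) < (p : ℝ) ^ (j + 1) := by positivity
    rw [div_le_iff₀ hpk, show 4 * (|b| * Real.log p) * ((((j + 1 : ℕ) : ℝ) + 1) ^ 4 / (p : ℝ) ^ (j + 1)) *
      (p : ℝ) ^ (j + 1) = (((j + 1 : ℕ) : ℝ) + 1) ^ 4 * (|b| * Real.log p) * 4 by field_simp]
    have e1 := mul_le_mul h1 h2 (norm_nonneg _) (by positivity)
    exact mul_le_mul e1 h3 (by positivity) (by positivity)
  refine (Finset.sum_le_sum hterm).trans ?_
  rw [← Finset.mul_sum]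
  have hC := sum_pow_four_div_pow_le hp.two_le K
  have hC40 : 0 ≤ C4 := le_trans (tsum_nonneg fun i => by positivity) hC4
  calc 4 * (|b| * Real.log p) * ∑ k ∈ Icc 1 K, ((k : ℝ) + 1) ^ 4 / (p : ℝ) ^ k
      ≤ 4 * (|b| * Real.log p) * ((∑' i : ℕ, ((i : ℝ) + 2) ^ 4 * (1 / 2 : ℝ) ^ i) / (p : ℝ)) :=
        mul_le_mul_of_nonneg_left hC (by positivity)
    _ ≤ 4 * (|b| * Real.log p) * (C4 / (p : ℝ)) :=
        mul_le_mul_of_nonneg_left (div_le_div_of_nonneg_right hC4 hp0.le) (by positivity)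
    _ = _ := by ring

/-- **The `ω(m₂) ≥ 2` sum**: for every `N`, real `b`, `C₄ ≥ Σ_i(i+2)⁴2^{−i}`, `β ≥ |b|` and
`L ≥ log N + log 4`,
`Σ_{2≤m≤N, m not a prime power} τ₄(m)|κ₂(m)|(m/φ(m))²/m ≤ Y·(e^Y − 1)` with `Y = 4C₄βL` (the engine
`sum_not_isPrimePow_div_le` with `X(p) = 4C₄|b|log p/p`, Mertens `Σ_{p≤N} log p/p ≤ log N + log 4`, and
the monotonicity of `y ↦ y(e^y − 1)`): in the chain `|b| ≍ α`, `log N ≍ 𝓛^{1.1}`, so the right side is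
`O((α𝓛^{1.1})²) = O(𝓛^{−15.8})` — the DOUBLE gain of composite `m₂`.
[cite: Zhang2022LandauSiegel, §17 u021 p. 98] -/
theorem sum_not_isPrimePow_Fkappa_le (b : ℝ) {C4 : ℝ} (hC4 : ∑' i : ℕ, ((i : ℝ) + 2) ^ 4 * (1 / 2 : ℝ) ^ i ≤ C4)
    {β : ℝ} (hβ : |b| ≤ β) (N : ℕ) {Lx : ℝ} (hL : Real.log N + Real.log 4 ≤ Lx) :
    ∑ m ∈ (Icc 2 N).filter (fun m => ¬ IsPrimePow m),
        tau 4 m * ‖kappa₂ b m‖ * ((m : ℝ) / Nat.totient m) ^ 2 / m ≤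
      (4 * C4 * β * Lx) * (Real.exp (4 * C4 * β * Lx) - 1) := by
  have hC40 : 0 ≤ C4 := le_trans (tsum_nonneg fun i => by positivity) hC4
  have hβ0 : 0 ≤ β := le_trans (abs_nonneg b) hβ
  have hlog4 : 0 ≤ Real.log 4 := Real.log_nonneg (by norm_num)
  have hLN0 : 0 ≤ Real.log N + Real.log 4 := add_nonneg (Real.log_natCast_nonneg N) hlog4
  have hL0 : 0 ≤ Lx := hLN0.trans hL
  obtain ⟨hf1, hf0, hmul⟩ := Fkappa_basic b
  set X : ℕ → ℝ := fun p => 4 * C4 * (|b| * Real.log p) / p with hX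
  have hX0 : ∀ p, 0 ≤ X p := fun p => by
    simp only [hX]
    exact div_nonneg (mul_nonneg (by positivity) (mul_nonneg (abs_nonneg b) (Real.log_natCast_nonneg p)))
      (Nat.cast_nonneg p)
  have key := sum_not_isPrimePow_div_le (F := fun m => tau 4 m * ‖kappa₂ b m‖ * ((m : ℝ) / Nat.totient m) ^ 2)
    hf1 hmul hf0 hX0 (fun p hp K => by simpa only [hX] using Fkappa_local_le b hC4 hp K) N
  -- `Σ_{p≤N} X p ≤ Y`
  have hY : ∑ p ∈ Nat.primesLE N, X p ≤ 4 * C4 * β * Lx := by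
    have h := MertensBound.sum_log_div_prime_le N
    calc ∑ p ∈ Nat.primesLE N, X p = 4 * C4 * |b| * ∑ p ∈ Nat.primesLE N, Real.log p / p := by
          rw [Finset.mul_sum]; refine Finset.sum_congr rfl fun p _ => ?_; simp only [hX]; ring
      _ ≤ 4 * C4 * |b| * (Real.log N + Real.log 4) := mul_le_mul_of_nonneg_left h (by positivity)
      _ ≤ 4 * C4 * β * Lx :=
          mul_le_mul (mul_le_mul_of_nonneg_left hβ (by positivity)) hL hLN0 (by positivity)
  -- monotonicity of `y ↦ y (e^y − 1)` on `y ≥ 0`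
  have hXs0 : 0 ≤ ∑ p ∈ Nat.primesLE N, X p := Finset.sum_nonneg fun p _ => hX0 p
  have hmono : (∑ p ∈ Nat.primesLE N, X p) * (Real.exp (∑ p ∈ Nat.primesLE N, X p) - 1) ≤
      (4 * C4 * β * Lx) * (Real.exp (4 * C4 * β * Lx) - 1) := by
    have h1 : 0 ≤ Real.exp (∑ p ∈ Nat.primesLE N, X p) - 1 := by
      have := Real.one_le_exp hXs0; linarith
    exact mul_le_mul hY (by gcongr) h1 (hXs0.trans hY)
  exact key.trans hmono

/-- `log p ≤ 2√p` (`log √p ≤ √p − 1`). [folklore] -/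
private theorem log_le_two_mul_sqrt {x : ℝ} (hx : 0 < x) : Real.log x ≤ 2 * Real.sqrt x := by
  have hs : 0 < Real.sqrt x := Real.sqrt_pos.mpr hx
  have h := Real.log_le_sub_one_of_pos hs
  rw [Real.log_sqrt hx.le] at h
  linarith

/-- The numerical constant `C₅ = Σ_{n≥1} n^{−3/2}` is finite. [folklore] -/
private theorem summable_rpow_three_halves : Summable (fun n : ℕ => ((n : ℝ) ^ (3 / 2 : ℝ))⁻¹) :=
  Real.summable_nat_rpow_inv.mpr (by norm_num)

/-- `log p / p² ≤ 2 / p^{3/2}` for `p ≥ 1`. [folklore] -/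
private theorem log_div_sq_le {p : ℕ} (hp : 1 ≤ p) :
    Real.log p / (p : ℝ) ^ 2 ≤ 2 * ((p : ℝ) ^ (3 / 2 : ℝ))⁻¹ := by
  have hp0 : (0 : ℝ) < p := by exact_mod_cast hp
  have hlog := log_le_two_mul_sqrt hp0
  have hsq : Real.sqrt (p : ℝ) = (p : ℝ) ^ (1 / 2 : ℝ) := Real.sqrt_eq_rpow _
  have h32 : (p : ℝ) ^ 2 = (p : ℝ) ^ (3 / 2 : ℝ) * (p : ℝ) ^ (1 / 2 : ℝ) := by
    rw [← Real.rpow_add hp0]; norm_num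
  have hpos32 : (0 : ℝ) < (p : ℝ) ^ (3 / 2 : ℝ) := Real.rpow_pos_of_pos hp0 _
  have hpos12 : (0 : ℝ) < (p : ℝ) ^ (1 / 2 : ℝ) := Real.rpow_pos_of_pos hp0 _
  rw [div_le_iff₀ (by positivity), h32]
  rw [hsq] at hlog
  calc Real.log p ≤ 2 * (p : ℝ) ^ (1 / 2 : ℝ) := hlog
    _ = 2 * ((p : ℝ) ^ (3 / 2 : ℝ))⁻¹ * ((p : ℝ) ^ (3 / 2 : ℝ) * (p : ℝ) ^ (1 / 2 : ℝ)) := by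
        field_simp

/-- **The prime-power sum** (`m₂ = p^k`, `k ≥ 2`): for every `N`, real `b`, `C₄' ≥ Σ_i(i+3)⁴2^{−i}`,
`C₅ ≥ Σ_n n^{−3/2}` and `β ≥ |b|`,
`Σ_{2≤m≤N, m a prime power, m not prime} τ₄(m)|κ₂(m)|(m/φ(m))²/m ≤ 8C₄'C₅·β`
(`|κ₂(p^k)| ≤ |b|log p`, `Σ_{k≥2}(k+1)⁴/p^k ≤ C₄'/p²`, `Σ_p log p/p² ≤ 2C₅`): a SINGLE gain `≍ α`, with no
decay in the size of `m₂` — this is the term that forces the relative currency of the piece.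
[cite: Zhang2022LandauSiegel, §17 u021 p. 98] -/
theorem sum_isPrimePow_not_prime_Fkappa_le (b : ℝ) {C4' C5 : ℝ}
    (hC4' : ∑' i : ℕ, ((i : ℝ) + 3) ^ 4 * (1 / 2 : ℝ) ^ i ≤ C4')
    (hC5 : ∑' n : ℕ, ((n : ℝ) ^ (3 / 2 : ℝ))⁻¹ ≤ C5) {β : ℝ} (hβ : |b| ≤ β) (N : ℕ) :
    ∑ m ∈ (Icc 2 N).filter (fun m => IsPrimePow m ∧ ¬ m.Prime),
        tau 4 m * ‖kappa₂ b m‖ * ((m : ℝ) / Nat.totient m) ^ 2 / m ≤ 8 * C4' * C5 * β := by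
  classical
  have hC4'0 : 0 ≤ C4' := le_trans (tsum_nonneg fun i => by positivity) hC4'
  have hC50 : 0 ≤ C5 := le_trans (tsum_nonneg fun n => by positivity) hC5
  have hβ0 : 0 ≤ β := le_trans (abs_nonneg b) hβ
  set g : ℕ → ℝ := fun m => tau 4 m * ‖kappa₂ b m‖ * ((m : ℝ) / Nat.totient m) ^ 2 / m with hg
  have hg0 : ∀ m, 0 ≤ g m := fun m =>
    div_nonneg (mul_nonneg (mul_nonneg (tau_nonneg 4 m) (norm_nonneg _)) (sq_nonneg _)) (Nat.cast_nonneg m)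
  set A' := (Icc 2 N).filter (fun m => IsPrimePow m ∧ ¬ m.Prime) with hA'
  set K₀ := Nat.log 2 N with hK₀
  -- cover `A'` by the pairs `(p, k)`, `p ≤ N` prime, `2 ≤ k ≤ K₀`
  have hcover : A' ⊆ (Nat.primesLE N ×ˢ Icc 2 K₀).image (fun z => z.1 ^ z.2) := by
    intro x hx
    rw [hA', Finset.mem_filter, Finset.mem_Icc] at hx
    obtain ⟨⟨hx2, hxN⟩, hpp, hnp⟩ := hx
    rw [isPrimePow_nat_iff] at hpp
    obtain ⟨p, k, hp, hk, rfl⟩ := hpp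
    have hk2 : 2 ≤ k := by
      by_contra h
      have : k = 1 := by omega
      subst this; rw [pow_one] at hnp; exact hnp hp
    rw [Finset.mem_image]
    refine ⟨(p, k), Finset.mem_product.mpr ⟨?_, ?_⟩, rfl⟩
    · rw [Nat.mem_primesLE]; exact ⟨le_trans (Nat.le_self_pow (by omega) p) hxN, hp⟩
    · rw [Finset.mem_Icc]; refine ⟨hk2, ?_⟩
      rw [hK₀]
      calc k ≤ Nat.log p (p ^ k) := by rw [Nat.log_pow hp.one_lt]
        _ ≤ Nat.log 2 (p ^ k) := Nat.log_anti_left (by norm_num) hp.two_le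
        _ ≤ Nat.log 2 N := Nat.log_mono_right hxN
  -- per prime: `Σ_{2≤k≤K₀} g(p^k) ≤ 4|b|log p · C₄'/p²`
  have hprime : ∀ p ∈ Nat.primesLE N, ∑ k ∈ Icc 2 K₀, g (p ^ k) ≤ 4 * (|b| * Real.log p) * (C4' / (p : ℝ) ^ 2) := by
    intro p hp
    have hp' := (Nat.mem_primesLE.1 hp).2
    have hp0 : (0 : ℝ) < p := by exact_mod_cast hp'.pos
    have hterm : ∀ k ∈ Icc 2 K₀, g (p ^ k) ≤ 4 * (|b| * Real.log p) * (((k : ℝ) + 1) ^ 4 / (p : ℝ) ^ k) := by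
      intro k hk
      obtain ⟨hk2, -⟩ := Finset.mem_Icc.mp hk
      obtain ⟨j, rfl⟩ : ∃ j, k = j + 1 := ⟨k - 1, by omega⟩
      simp only [hg]
      push_cast
      have h1 : tau 4 (p ^ (j + 1)) ≤ (((j + 1 : ℕ) : ℝ) + 1) ^ 4 := by
        have := tau_prime_pow_le 4 hp' (j + 1); push_cast at this ⊢; exact this
      have h2 : ‖kappa₂ b (p ^ (j + 1))‖ ≤ |b| * Real.log p := AppendixA.norm_kappa₂_prime_pow_succ_le b hp' j
      have h3 : (((p ^ (j + 1) : ℕ) : ℝ) / Nat.totient (p ^ (j + 1))) ^ 2 ≤ 4 :=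
        ratio_totient_sq_prime_pow_le hp' (j + 1)
      push_cast at h1 h3
      have hpk : (0 : ℝ) < (p : ℝ) ^ (j + 1) := by positivity
      rw [div_le_iff₀ hpk, show 4 * (|b| * Real.log p) * (((j : ℝ) + 1 + 1) ^ 4 / (p : ℝ) ^ (j + 1)) *
        (p : ℝ) ^ (j + 1) = ((j : ℝ) + 1 + 1) ^ 4 * (|b| * Real.log p) * 4 by field_simp]
      have e1 := mul_le_mul h1 h2 (norm_nonneg _) (by positivity)
      exact mul_le_mul e1 h3 (by positivity) (by positivity)
    refine (Finset.sum_le_sum hterm).trans ?_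
    rw [← Finset.mul_sum]
    refine mul_le_mul_of_nonneg_left ?_ (mul_nonneg (by norm_num) (mul_nonneg (abs_nonneg b) (Real.log_natCast_nonneg p)))
    exact (sum_pow_four_div_pow_le_two hp'.two_le K₀).trans (div_le_div_of_nonneg_right hC4' (by positivity))
  -- `Σ_p log p / p² ≤ 2 C₅`
  have hlogsum : ∑ p ∈ Nat.primesLE N, Real.log p / (p : ℝ) ^ 2 ≤ 2 * C5 := by
    calc ∑ p ∈ Nat.primesLE N, Real.log p / (p : ℝ) ^ 2
        ≤ ∑ p ∈ Nat.primesLE N, 2 * ((p : ℝ) ^ (3 / 2 : ℝ))⁻¹ :=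
          Finset.sum_le_sum fun p hp => log_div_sq_le (Nat.mem_primesLE.1 hp).2.one_lt.le
      _ = 2 * ∑ p ∈ Nat.primesLE N, ((p : ℝ) ^ (3 / 2 : ℝ))⁻¹ := by rw [Finset.mul_sum]
      _ ≤ 2 * C5 := by
          refine mul_le_mul_of_nonneg_left ?_ (by norm_num)
          exact (summable_rpow_three_halves.sum_le_tsum _ (fun n _ => by positivity)).trans hC5
  calc ∑ m ∈ A', g m ≤ ∑ x ∈ (Nat.primesLE N ×ˢ Icc 2 K₀).image (fun z => z.1 ^ z.2), g x :=
        Finset.sum_le_sum_of_subset_of_nonneg hcover fun x _ _ => hg0 x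
    _ ≤ ∑ z ∈ Nat.primesLE N ×ˢ Icc 2 K₀, g (z.1 ^ z.2) := Finset.sum_image_le_of_nonneg fun z _ => hg0 _
    _ = ∑ p ∈ Nat.primesLE N, ∑ k ∈ Icc 2 K₀, g (p ^ k) := Finset.sum_product _ _ _
    _ ≤ ∑ p ∈ Nat.primesLE N, 4 * (|b| * Real.log p) * (C4' / (p : ℝ) ^ 2) := Finset.sum_le_sum hprime
    _ = 4 * C4' * |b| * ∑ p ∈ Nat.primesLE N, Real.log p / (p : ℝ) ^ 2 := by
        rw [Finset.mul_sum]; refine Finset.sum_congr rfl fun p _ => ?_; ring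
    _ ≤ 4 * C4' * |b| * (2 * C5) := mul_le_mul_of_nonneg_left hlogsum (by positivity)
    _ ≤ 4 * C4' * β * (2 * C5) := by
        have : 0 ≤ 2 * C5 := by positivity
        exact mul_le_mul_of_nonneg_right (mul_le_mul_of_nonneg_left hβ (by positivity)) this
    _ = 8 * C4' * C5 * β := by ring

end MTwoSums

/-! ## §6. The inner double sum at a fixed pair `(l₁, l₂)` -/

section Inner

variable (c' : ℝ) {D : ℕ} (χ : DirichletCharacter ℂ D)

omit χ in
/-- `b(0) = 0` (empty antidiagonal). [cite: Zhang2022LandauSiegel, §15 (15.1)] -/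
theorem bcoef_zero : bcoef D 0 = 0 := by simp [bcoef]

/-- **The inner `(m₁, m₂)`-sum over composite `m₂`, at a fixed pair `(l₁, l₂)`.** Let `𝓛 > 0`,
`𝓛 ≥ 3`, let `C_M` be a constant of the `m₁`-sum majorant (M1, `m1Sum_le`), and let `C₄, C₄', C₅, β, L`
dominate the numerical series, `|b₁|` and `log⌈4(D⁴+1)T⁴⌉ + log 4`. For any side condition `Q` implying
`2 ≤ m₂` and `m₂` not prime,
`Σ'_{m₁}Σ'_{m₂}[Q(m₂)]·|b(l₁m₁)|·|ν₁*(l₂m₂)|·|κ̄₂(m₁m₂)|/(m₁m₂) ≤ C_M·τ₂(l₁)·τ₄(l₂)·(Y(e^Y − 1) + 8C₄'C₅β)`,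
`Y = 4C₄βL`. [cite: Zhang2022LandauSiegel, §17 u021 p. 98] -/
theorem inner_composite_le (hℓ : 3 ≤ ell D) {CM : ℝ} (hCM : 0 ≤ CM)
    (hM1 : ∀ q₁ m₂ : ℕ, 1 ≤ q₁ → 1 ≤ m₂ →
      (∑' m₁ : ℕ, ‖bcoef D (q₁ * m₁)‖ * ‖kappa2bar c' D (m₁ * m₂)‖ / (m₁ : ℝ)) ≤
        CM * (q₁.divisors.card : ℝ) * ‖kappa2bar c' D m₂‖ * ((m₂ : ℝ) / m₂.totient) ^ 2)
    {C4 C4' C5 β Lx : ℝ} (hC4 : ∑' i : ℕ, ((i : ℝ) + 2) ^ 4 * (1 / 2 : ℝ) ^ i ≤ C4)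
    (hC4' : ∑' i : ℕ, ((i : ℝ) + 3) ^ 4 * (1 / 2 : ℝ) ^ i ≤ C4')
    (hC5 : ∑' n : ℕ, ((n : ℝ) ^ (3 / 2 : ℝ))⁻¹ ≤ C5) (hβ : |b1 c' D| ≤ β)
    (hL : Real.log (⌈4 * ((D : ℝ) ^ 4 + 1) * bigT D ^ 4⌉₊ : ℕ) + Real.log 4 ≤ Lx)
    {l₁ l₂ : ℕ} (hl₁ : 1 ≤ l₁) (hl₂ : 1 ≤ l₂) (Q : ℕ → Prop) [DecidablePred Q]
    (hQ : ∀ m, Q m → 2 ≤ m ∧ ¬ m.Prime) :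
    (∑' m₁ : ℕ, ∑' m₂ : ℕ,
      if Q m₂ then ‖bcoef D (l₁ * m₁)‖ * ‖nuOneStar c' χ (l₂ * m₂)‖ * ‖kappa2bar c' D (m₁ * m₂)‖ /
        ((m₁ : ℝ) * m₂) else 0) ≤
      CM * tau 2 l₁ * tau 4 l₂ *
        ((4 * C4 * β * Lx) * (Real.exp (4 * C4 * β * Lx) - 1) + 8 * C4' * C5 * β) := by
  classical
  have hℓ0 : 0 < ell D := by linarith
  set b : ℝ := b1 c' D with hb
  set N₂ : ℕ := ⌈4 * ((D : ℝ) ^ 4 + 1) * bigT D ^ 4⌉₊ with hN₂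
  set N₁ : ℕ := ⌈bigP D / bigT D ^ 2⌉₊ with hN₁
  set f : ℕ → ℕ → ℝ := fun m₁ m₂ =>
    if Q m₂ then ‖bcoef D (l₁ * m₁)‖ * ‖nuOneStar c' χ (l₂ * m₂)‖ * ‖kappa2bar c' D (m₁ * m₂)‖ /
      ((m₁ : ℝ) * m₂) else 0 with hf
  -- support in `m₂`
  have hsupp₂ : ∀ m₁, ∀ m₂ ∉ Icc 2 N₂, f m₁ m₂ = 0 := by
    intro m₁ m₂ hm₂
    simp only [hf]
    split_ifs with hq
    · have h2 := (hQ m₂ hq).1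
      have hbig : N₂ < m₂ := by
        by_contra h; exact hm₂ (Finset.mem_Icc.mpr ⟨h2, not_lt.mp h⟩)
      have hν : nuOneStar c' χ (l₂ * m₂) = 0 := by
        refine nuOneStar_eq_zero_of_le c' χ ?_
        calc 4 * ((D : ℝ) ^ 4 + 1) * bigT D ^ 4 ≤ N₂ := Nat.le_ceil _
          _ ≤ m₂ := by exact_mod_cast hbig.le
          _ ≤ ((l₂ * m₂ : ℕ) : ℝ) := by exact_mod_cast Nat.le_mul_of_pos_left m₂ hl₂
      rw [hν, norm_zero, mul_zero, zero_mul, zero_div]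
    · rfl
  -- support in `m₁`
  have hsupp₁ : ∀ m₂, ∀ m₁ ∉ Icc 1 N₁, f m₁ m₂ = 0 := by
    intro m₂ m₁ hm₁
    simp only [hf]
    split_ifs with hq
    · have hb0 : bcoef D (l₁ * m₁) = 0 := by
        rcases Nat.eq_zero_or_pos m₁ with rfl | hpos
        · rw [mul_zero]; exact bcoef_zero
        · have hbig : N₁ < m₁ := by
            by_contra h; exact hm₁ (Finset.mem_Icc.mpr ⟨hpos, not_lt.mp h⟩)
          refine bcoef_eq_zero_of_le hℓ ?_
          calc bigP D / bigT D ^ 2 ≤ N₁ := Nat.le_ceil _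
            _ ≤ m₁ := by exact_mod_cast hbig.le
            _ ≤ ((l₁ * m₁ : ℕ) : ℝ) := by exact_mod_cast Nat.le_mul_of_pos_left m₁ hl₁
      rw [hb0, norm_zero, zero_mul, zero_mul, zero_div]
    · rfl
  -- tsums to finite sums
  have h1 : ∀ m₁, ∑' m₂, f m₁ m₂ = ∑ m₂ ∈ Icc 2 N₂, f m₁ m₂ := fun m₁ => tsum_eq_sum (hsupp₂ m₁)
  have hsum₁ : ∀ m₂, Summable (fun m₁ => f m₁ m₂) := fun m₂ => summable_of_ne_finset_zero (hsupp₁ m₂)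
  have h2 : ∑' m₁, ∑' m₂, f m₁ m₂ = ∑ m₂ ∈ Icc 2 N₂, ∑' m₁, f m₁ m₂ := by
    simp_rw [h1]
    exact Summable.tsum_finsetSum fun m₂ _ => hsum₁ m₂
  -- each `m₁`-tsum
  have h3 : ∀ m₂ ∈ Icc 2 N₂, ∑' m₁, f m₁ m₂ ≤
      (if Q m₂ then ‖nuOneStar c' χ (l₂ * m₂)‖ / m₂ else 0) *
        (CM * (l₁.divisors.card : ℝ) * ‖kappa2bar c' D m₂‖ * ((m₂ : ℝ) / m₂.totient) ^ 2) := by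
    intro m₂ hm₂
    obtain ⟨hm₂2, -⟩ := Finset.mem_Icc.mp hm₂
    have hfac : ∀ m₁, f m₁ m₂ = (if Q m₂ then ‖nuOneStar c' χ (l₂ * m₂)‖ / m₂ else 0) *
        (‖bcoef D (l₁ * m₁)‖ * ‖kappa2bar c' D (m₁ * m₂)‖ / (m₁ : ℝ)) := by
      intro m₁
      simp only [hf]
      split_ifs
      · rw [div_mul_div_comm]; ring
      · rw [zero_mul]
    simp_rw [hfac]
    rw [tsum_mul_left]
    refine mul_le_mul_of_nonneg_left (hM1 l₁ m₂ hl₁ (by omega)) ?_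
    split_ifs <;> positivity
  -- the composite-`m₂` weight
  set g : ℕ → ℝ := fun m => tau 4 m * ‖kappa₂ b m‖ * ((m : ℝ) / Nat.totient m) ^ 2 / m with hg
  have hg0 : ∀ m, 0 ≤ g m := fun m =>
    div_nonneg (mul_nonneg (mul_nonneg (tau_nonneg 4 m) (norm_nonneg _)) (sq_nonneg _)) (Nat.cast_nonneg m)
  have hpre : 0 ≤ CM * tau 2 l₁ * tau 4 l₂ := by
    have := tau_nonneg 2 l₁; have := tau_nonneg 4 l₂; positivity
  have h4 : ∀ m₂ ∈ Icc 2 N₂,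
      (if Q m₂ then ‖nuOneStar c' χ (l₂ * m₂)‖ / m₂ else 0) *
        (CM * (l₁.divisors.card : ℝ) * ‖kappa2bar c' D m₂‖ * ((m₂ : ℝ) / m₂.totient) ^ 2) ≤
      CM * tau 2 l₁ * tau 4 l₂ * (if ¬ m₂.Prime then g m₂ else 0) := by
    intro m₂ hm₂
    obtain ⟨hm₂2, -⟩ := Finset.mem_Icc.mp hm₂
    have hm₂0 : (0 : ℝ) < m₂ := by exact_mod_cast (by omega : 0 < m₂)
    rw [← tau_two_apply l₁, norm_kappa2bar_eq c' D m₂, ← hb]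
    by_cases hq : Q m₂
    · have hnp : ¬ m₂.Prime := (hQ m₂ hq).2
      rw [if_pos hq, if_pos hnp]
      have hν : ‖nuOneStar c' χ (l₂ * m₂)‖ ≤ tau 4 l₂ * tau 4 m₂ :=
        (norm_nuOneStar_le_tau_four c' χ hℓ0 _).trans (tau_mul_le 4 l₂ m₂)
      simp only [hg]
      rw [div_mul_eq_mul_div, div_le_iff₀ hm₂0]
      have hrhs : CM * tau 2 l₁ * tau 4 l₂ * (tau 4 m₂ * ‖kappa₂ b m₂‖ * ((m₂ : ℝ) / Nat.totient m₂) ^ 2 / m₂) *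
          m₂ = (tau 4 l₂ * tau 4 m₂) * (CM * tau 2 l₁ * ‖kappa₂ b m₂‖ * ((m₂ : ℝ) / Nat.totient m₂) ^ 2) := by
        field_simp
      rw [hrhs]
      exact mul_le_mul_of_nonneg_right hν (by
        have := tau_nonneg 2 l₁; positivity)
    · rw [if_neg hq, zero_mul]
      exact mul_nonneg hpre (by split_ifs <;> first | exact hg0 _ | exact le_rfl)
  -- collect
  have h5 : ∑ m₂ ∈ Icc 2 N₂, ∑' m₁, f m₁ m₂ ≤
      CM * tau 2 l₁ * tau 4 l₂ * ∑ m₂ ∈ (Icc 2 N₂).filter (fun m => ¬ m.Prime), g m₂ := by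
    rw [Finset.sum_filter, Finset.mul_sum]
    exact Finset.sum_le_sum fun m₂ hm₂ => (h3 m₂ hm₂).trans (h4 m₂ hm₂)
  -- split `¬ prime` into `¬ prime power` and `prime power, not prime`
  have h6 : ∑ m₂ ∈ (Icc 2 N₂).filter (fun m => ¬ m.Prime), g m₂ ≤
      ∑ m₂ ∈ (Icc 2 N₂).filter (fun m => ¬ IsPrimePow m), g m₂ +
        ∑ m₂ ∈ (Icc 2 N₂).filter (fun m => IsPrimePow m ∧ ¬ m.Prime), g m₂ := by
    rw [← Finset.sum_filter_add_sum_filter_not ((Icc 2 N₂).filter (fun m => ¬ m.Prime)) (fun m => IsPrimePow m),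
      Finset.filter_filter, Finset.filter_filter, add_comm]
    refine add_le_add ?_ ?_
    · refine Finset.sum_le_sum_of_subset_of_nonneg (fun m hm => ?_) (fun m _ _ => hg0 m)
      rw [Finset.mem_filter] at hm ⊢; exact ⟨hm.1, hm.2.2⟩
    · refine Finset.sum_le_sum_of_subset_of_nonneg (fun m hm => ?_) (fun m _ _ => hg0 m)
      rw [Finset.mem_filter] at hm ⊢; exact ⟨hm.1, hm.2.2, hm.2.1⟩
  have hOm := sum_not_isPrimePow_Fkappa_le b hC4 hβ N₂ hL
  have hPP := sum_isPrimePow_not_prime_Fkappa_le b hC4' hC5 hβ N₂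
  calc ∑' m₁, ∑' m₂, f m₁ m₂ = ∑ m₂ ∈ Icc 2 N₂, ∑' m₁, f m₁ m₂ := h2
    _ ≤ CM * tau 2 l₁ * tau 4 l₂ * ∑ m₂ ∈ (Icc 2 N₂).filter (fun m => ¬ m.Prime), g m₂ := h5
    _ ≤ CM * tau 2 l₁ * tau 4 l₂ *
        (∑ m₂ ∈ (Icc 2 N₂).filter (fun m => ¬ IsPrimePow m), g m₂ +
          ∑ m₂ ∈ (Icc 2 N₂).filter (fun m => IsPrimePow m ∧ ¬ m.Prime), g m₂) :=
        mul_le_mul_of_nonneg_left h6 hpre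
    _ ≤ _ := mul_le_mul_of_nonneg_left (add_le_add hOm hPP) hpre

end Inner

/-! ## §7. The outer `l`-sum and the eventual statement -/

section Outer

variable (c' : ℝ) {D : ℕ} (χ : DirichletCharacter ℂ D)

/-- **The fully summed composite range at a fixed large modulus, against the weight `Σ_{l<D⁴}|ν(l)|τ₆(l)/l`.**
With the data of `inner_composite_le` and any family of side conditions `Q(l₁,l₂,·)` implying `2 ≤ m₂`,
`m₂` not prime:
`Σ_{l<D⁴}|ν(l)|/l·Σ_{l=l₁l₂}Σ'_{m₁}Σ'_{m₂}[Q]·(…) ≤ C_M(Y(e^Y−1) + 8C₄'C₅β)·Σ_{l<D⁴}|ν(l)|τ₆(l)/l`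
(`Σ_{l=l₁l₂}τ₂(l₁)τ₄(l₂) = τ₆(l)`, `tau_add_apply`). [cite: Zhang2022LandauSiegel, §17 u021 p. 98] -/
theorem outer_composite_le (hℓ : 3 ≤ ell D) {CM : ℝ} (hCM : 0 ≤ CM)
    (hM1 : ∀ q₁ m₂ : ℕ, 1 ≤ q₁ → 1 ≤ m₂ →
      (∑' m₁ : ℕ, ‖bcoef D (q₁ * m₁)‖ * ‖kappa2bar c' D (m₁ * m₂)‖ / (m₁ : ℝ)) ≤
        CM * (q₁.divisors.card : ℝ) * ‖kappa2bar c' D m₂‖ * ((m₂ : ℝ) / m₂.totient) ^ 2)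
    {C4 C4' C5 β Lx : ℝ} (hC4 : ∑' i : ℕ, ((i : ℝ) + 2) ^ 4 * (1 / 2 : ℝ) ^ i ≤ C4)
    (hC4' : ∑' i : ℕ, ((i : ℝ) + 3) ^ 4 * (1 / 2 : ℝ) ^ i ≤ C4')
    (hC5 : ∑' n : ℕ, ((n : ℝ) ^ (3 / 2 : ℝ))⁻¹ ≤ C5) (hβ : |b1 c' D| ≤ β)
    (hL : Real.log (⌈4 * ((D : ℝ) ^ 4 + 1) * bigT D ^ 4⌉₊ : ℕ) + Real.log 4 ≤ Lx)
    (Q : ℕ → ℕ → ℕ → Prop) [∀ a b, DecidablePred (Q a b)]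
    (hQ : ∀ a b m, Q a b m → 2 ≤ m ∧ ¬ m.Prime) :
    ∑ l ∈ Finset.Ico 1 (D ^ 4), ‖nu χ l‖ / l * ∑ q ∈ l.divisorsAntidiagonal, ∑' m₁ : ℕ, ∑' m₂ : ℕ,
        (if Q q.1 q.2 m₂ then ‖bcoef D (q.1 * m₁)‖ * ‖nuOneStar c' χ (q.2 * m₂)‖ *
          ‖kappa2bar c' D (m₁ * m₂)‖ / ((m₁ : ℝ) * m₂) else 0) ≤
      CM * ((4 * C4 * β * Lx) * (Real.exp (4 * C4 * β * Lx) - 1) + 8 * C4' * C5 * β) *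
        ∑ l ∈ Finset.Ico 1 (D ^ 4), ‖nu χ l‖ * tau 6 l / l := by
  classical
  set W : ℝ := (4 * C4 * β * Lx) * (Real.exp (4 * C4 * β * Lx) - 1) + 8 * C4' * C5 * β with hW
  rw [Finset.mul_sum]
  refine Finset.sum_le_sum fun l hl => ?_
  obtain ⟨hl1, -⟩ := Finset.mem_Ico.mp hl
  have hl0 : (0 : ℝ) < l := by exact_mod_cast hl1
  have hν0 : 0 ≤ ‖nu χ l‖ / l := div_nonneg (norm_nonneg _) hl0.le
  have hq : ∀ q ∈ l.divisorsAntidiagonal, (∑' m₁ : ℕ, ∑' m₂ : ℕ,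
      (if Q q.1 q.2 m₂ then ‖bcoef D (q.1 * m₁)‖ * ‖nuOneStar c' χ (q.2 * m₂)‖ *
        ‖kappa2bar c' D (m₁ * m₂)‖ / ((m₁ : ℝ) * m₂) else 0)) ≤ CM * tau 2 q.1 * tau 4 q.2 * W := by
    intro q hq
    obtain ⟨hprod, hl0'⟩ := Nat.mem_divisorsAntidiagonal.mp hq
    have hq1 : 1 ≤ q.1 := Nat.one_le_iff_ne_zero.mpr fun h => hl0' (by rw [← hprod, h, zero_mul])
    have hq2 : 1 ≤ q.2 := Nat.one_le_iff_ne_zero.mpr fun h => hl0' (by rw [← hprod, h, mul_zero])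
    exact inner_composite_le c' χ hℓ hCM hM1 hC4 hC4' hC5 hβ hL hq1 hq2 (Q q.1 q.2) (hQ q.1 q.2)
  have h6 : tau 6 l = ∑ q ∈ l.divisorsAntidiagonal, tau 2 q.1 * tau 4 q.2 := by
    rw [show (6 : ℕ) = 2 + 4 by norm_num]; exact tau_add_apply 2 4 l
  calc ‖nu χ l‖ / l * ∑ q ∈ l.divisorsAntidiagonal, (∑' m₁ : ℕ, ∑' m₂ : ℕ,
        (if Q q.1 q.2 m₂ then ‖bcoef D (q.1 * m₁)‖ * ‖nuOneStar c' χ (q.2 * m₂)‖ *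
          ‖kappa2bar c' D (m₁ * m₂)‖ / ((m₁ : ℝ) * m₂) else 0))
      ≤ ‖nu χ l‖ / l * ∑ q ∈ l.divisorsAntidiagonal, CM * tau 2 q.1 * tau 4 q.2 * W :=
        mul_le_mul_of_nonneg_left (Finset.sum_le_sum hq) hν0
    _ = CM * W * (‖nu χ l‖ * tau 6 l / l) := by
        have hS : ∑ q ∈ l.divisorsAntidiagonal, CM * tau 2 q.1 * tau 4 q.2 * W =
            CM * W * ∑ q ∈ l.divisorsAntidiagonal, tau 2 q.1 * tau 4 q.2 := by
          rw [Finset.mul_sum]; exact Finset.sum_congr rfl (fun q _ => by ring)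
        rw [hS, ← h6]
        field_simp

omit χ in
/-- Size bookkeeping for the eventual statement: `log⌈4(D⁴+1)T⁴⌉ + log 4 ≤ 13𝓛²` once `𝓛 ≥ 1`
(`T = e^{𝓛^{1.1}}`, `𝓛^{1.1} ≤ 𝓛²`). [cite: Zhang2022LandauSiegel, §2 (2.6)] -/
theorem log_N2_add_log_four_le (hℓ : 1 ≤ ell D) :
    Real.log (⌈4 * ((D : ℝ) ^ 4 + 1) * bigT D ^ 4⌉₊ : ℕ) + Real.log 4 ≤ 13 * ell D ^ 2 := by
  have hℓ0 : 0 < ell D := by linarith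
  have hD0 : (0 : ℝ) < D := by
    rcases Nat.eq_zero_or_pos D with h | h
    · subst h; simp [ell] at hℓ; linarith
    · exact_mod_cast h
  have hD1 : (1 : ℝ) ≤ D := by
    have : Real.exp (ell D) = D := by rw [ell, Real.exp_log hD0]
    rw [← this]; exact Real.one_le_exp (by linarith)
  have hT : bigT D = Real.exp (ell D ^ (1.1 : ℝ)) := rfl
  have hT0 : 0 < bigT D := by rw [hT]; exact Real.exp_pos _
  have hT1 : 1 ≤ bigT D := by rw [hT]; exact Real.one_le_exp (Real.rpow_nonneg hℓ0.le _)
  have h11 : ell D ^ (1.1 : ℝ) ≤ ell D ^ 2 := by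
    have := Real.rpow_le_rpow_of_exponent_le hℓ (by norm_num : (1.1 : ℝ) ≤ 2)
    rwa [Real.rpow_two] at this
  set x : ℝ := 4 * ((D : ℝ) ^ 4 + 1) * bigT D ^ 4 with hx
  have hDT : 1 ≤ (D : ℝ) ^ 4 * bigT D ^ 4 := one_le_mul_of_one_le_of_one_le (one_le_pow₀ hD1) (one_le_pow₀ hT1)
  have hx1 : 1 ≤ x := by
    rw [hx]
    have hT4 : (0 : ℝ) ≤ bigT D ^ 4 := by positivity
    nlinarith
  have hx0 : 0 ≤ x := by linarith
  have hceil : ((⌈x⌉₊ : ℕ) : ℝ) ≤ x + 1 := (Nat.ceil_lt_add_one hx0).le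
  have hx9 : x + 1 ≤ 9 * ((D : ℝ) ^ 4 * bigT D ^ 4) := by
    rw [hx]
    have hT4 : bigT D ^ 4 ≤ (D : ℝ) ^ 4 * bigT D ^ 4 :=
      le_mul_of_one_le_left (by positivity) (one_le_pow₀ hD1)
    nlinarith
  have hpos : (0 : ℝ) < ((⌈x⌉₊ : ℕ) : ℝ) := by
    have h1 : (1 : ℝ) ≤ ((⌈x⌉₊ : ℕ) : ℝ) := by
      have := Nat.le_ceil x
      linarith
    linarith
  have hlog : Real.log ((⌈x⌉₊ : ℕ) : ℝ) ≤ Real.log 9 + 4 * ell D + 4 * ell D ^ (1.1 : ℝ) := by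
    calc Real.log ((⌈x⌉₊ : ℕ) : ℝ) ≤ Real.log (9 * ((D : ℝ) ^ 4 * bigT D ^ 4)) :=
          Real.log_le_log hpos (hceil.trans hx9)
      _ = Real.log 9 + 4 * ell D + 4 * ell D ^ (1.1 : ℝ) := by
          rw [Real.log_mul (by norm_num) (by positivity), Real.log_mul (by positivity) (by positivity),
            Real.log_pow, Real.log_pow, hT, Real.log_exp, ← ell]
          push_cast; ring
  have he1 := Real.exp_one_gt_d9
  have hlog9 : Real.log 9 ≤ 3 := by
    have h3 : Real.exp 1 ^ 3 = Real.exp 3 := by rw [← Real.exp_nat_mul]; norm_num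
    have h9 : (9 : ℝ) ≤ Real.exp 3 := by
      rw [← h3]
      have := pow_le_pow_left₀ (by norm_num) he1.le 3
      nlinarith
    have : Real.log 9 ≤ Real.log (Real.exp 3) := Real.log_le_log (by norm_num) h9
    rwa [Real.log_exp] at this
  have hlog4 : Real.log 4 ≤ 2 := by
    have h2 : Real.exp 1 ^ 2 = Real.exp 2 := by rw [← Real.exp_nat_mul]; norm_num
    have h4 : (4 : ℝ) ≤ Real.exp 2 := by
      rw [← h2]
      have := pow_le_pow_left₀ (by norm_num) he1.le 2
      nlinarith
    have : Real.log 4 ≤ Real.log (Real.exp 2) := Real.log_le_log (by norm_num) h4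
    rwa [Real.log_exp] at this
  have hℓsq : ell D ≤ ell D ^ 2 := by nlinarith
  have h1sq : 1 ≤ ell D ^ 2 := by nlinarith
  linarith

/-- Elementary: for `0 ≤ y ≤ 1`, `y(e^y − 1) ≤ 2y²` (`e^y − 1 ≤ 2y` on `[0,1]`). [folklore] -/
private theorem mul_exp_sub_one_le {y : ℝ} (h0 : 0 ≤ y) (h1 : y ≤ 1) : y * (Real.exp y - 1) ≤ 2 * y ^ 2 := by
  have h := Real.abs_exp_sub_one_le (x := y) (by rw [abs_of_nonneg h0]; exact h1)
  rw [abs_of_nonneg h0] at h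
  have h' : Real.exp y - 1 ≤ 2 * y := le_trans (le_abs_self _) h
  calc y * (Real.exp y - 1) ≤ y * (2 * y) := mul_le_mul_of_nonneg_left h' h0
    _ = 2 * y ^ 2 := by ring

/-- **M2L-c, the composite large-argument range of `R₁`, fully summed, in the relative currency** —
GIVEN the `𝔞`-currency outer count `Σ_{l<D⁴}|ν(l)|τ₆(l)/l ≤ C(𝔞+1)³` (piece A1b of the cut; `hcount`):
for every `ε > 0`, for all large `D`, under (A),
`Σ_{l<D⁴}|ν(l)|/l Σ_{l=l₁l₂}Σ_{m₁}Σ_{m₂: l₂m₂>D⁴, m₂≥2 composite, (m₂,l₁)=1}|b(l₁m₁)||ν₁*(l₂m₂)||κ̄₂(m₁m₂)|/(m₁m₂)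
≤ ε(𝔞+1)`. Sizes: `|b₁| ≤ (1+5|c′|π)α`, `α = π𝓛⁻⁹`; composite `m₂` with two distinct primes carry the
double gain `Y(e^Y−1) ≤ 2Y² ≍ 𝓛^{−14}`, prime powers `p^k` (`k ≥ 2`) the single gain `≍ α`; the outer count
costs `(𝔞+1)³` with `𝔞+1 ≤ (16e⁹+1)𝓛⁴` (`frakA_le_ell_pow_four'`), whence the total is
`≪ 𝓛⁻¹·(𝔞+1) ≤ ε(𝔞+1)`. The `m₁`-sum is zl-w11-p3's `m1Sum_le` (M1). [cite: Zhang2022LandauSiegel, §17 u021 p. 98] -/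
theorem R1_composite_large_small_of_count
    (hcount : ∃ C : ℝ, ForAllLarge fun D _ χ => AssumptionA D χ →
      ∑ l ∈ Finset.Ico 1 (D ^ 4), ‖nu χ l‖ * tau 6 l / l ≤ C * (frakA χ + 1) ^ 3) :
    ∀ ε : ℝ, 0 < ε → ForAllLarge fun D _ χ => AssumptionA D χ →
      ∑ l ∈ Finset.Ico 1 (D ^ 4), ‖nu χ l‖ / l * ∑ q ∈ l.divisorsAntidiagonal, ∑' m₁ : ℕ, ∑' m₂ : ℕ,
        (if (D : ℝ) ^ 4 < q.2 * m₂ ∧ 2 ≤ m₂ ∧ ¬ m₂.Prime ∧ Nat.Coprime m₂ q.1 then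
          ‖bcoef D (q.1 * m₁)‖ * ‖nuOneStar c' χ (q.2 * m₂)‖ * ‖kappa2bar c' D (m₁ * m₂)‖ /
            ((m₁ : ℝ) * m₂) else 0) ≤ ε * (frakA χ + 1) := by
  intro ε hε
  obtain ⟨CA, hCA⟩ := hcount
  obtain ⟨CM₀, hM⟩ := m1Sum_le c'
  obtain ⟨D₁, hD₁⟩ := hCA
  obtain ⟨D₂, hD₂⟩ := hM
  -- numerical constants (opaque names with their defining bounds)
  obtain ⟨C4, hC4⟩ : ∃ C : ℝ, ∑' i : ℕ, ((i : ℝ) + 2) ^ 4 * (1 / 2 : ℝ) ^ i ≤ C := ⟨_, le_rfl⟩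
  obtain ⟨C4', hC4'⟩ : ∃ C : ℝ, ∑' i : ℕ, ((i : ℝ) + 3) ^ 4 * (1 / 2 : ℝ) ^ i ≤ C := ⟨_, le_rfl⟩
  obtain ⟨C5, hC5⟩ : ∃ C : ℝ, ∑' n : ℕ, ((n : ℝ) ^ (3 / 2 : ℝ))⁻¹ ≤ C := ⟨_, le_rfl⟩
  have hC40 : 0 ≤ C4 := le_trans (tsum_nonneg fun i => by positivity) hC4
  have hC4'0 : 0 ≤ C4' := le_trans (tsum_nonneg fun i => by positivity) hC4'
  have hC50 : 0 ≤ C5 := le_trans (tsum_nonneg fun n => by positivity) hC5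
  obtain ⟨CM, hCMge, hCM0⟩ : ∃ C : ℝ, CM₀ ≤ C ∧ 0 ≤ C := ⟨max CM₀ 0, le_max_left _ _, le_max_right _ _⟩
  obtain ⟨CA', hCAge, hCA'0⟩ : ∃ C : ℝ, CA ≤ C ∧ 0 ≤ C := ⟨max CA 0, le_max_left _ _, le_max_right _ _⟩
  obtain ⟨Kb, hKb⟩ : ∃ K : ℝ, K = (1 + 5 * |c'| * π) * π := ⟨_, rfl⟩
  have hKb0 : 0 ≤ Kb := by rw [hKb]; positivity
  obtain ⟨KY, hKY⟩ : ∃ K : ℝ, K = 4 * C4 * Kb * 13 := ⟨_, rfl⟩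
  have hKY0 : 0 ≤ KY := by rw [hKY]; positivity
  obtain ⟨KP, hKP⟩ : ∃ K : ℝ, K = 8 * C4' * C5 * Kb := ⟨_, rfl⟩
  have hKP0 : 0 ≤ KP := by rw [hKP]; positivity
  obtain ⟨KA, hKA⟩ : ∃ K : ℝ, K = 16 * Real.exp 9 + 1 := ⟨_, rfl⟩
  have hKA0 : 0 ≤ KA := by rw [hKA]; positivity
  obtain ⟨K, hK⟩ : ∃ K₀ : ℝ, K₀ = CM * (2 * KY ^ 2 + KP) * CA' * KA ^ 2 := ⟨_, rfl⟩
  have hK0 : 0 ≤ K := by rw [hK]; positivity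
  obtain ⟨D₃, hD₃⟩ := Section7Eq75.exists_nat_le_ell (max 3 (max (KY + 1) (K / ε + 1)))
  refine ⟨max (max D₁ D₂) D₃, fun D _ χ hD hq hp hA => ?_⟩
  have hD1 : D₁ ≤ D := le_trans (le_trans (le_max_left _ _) (le_max_left _ _)) hD
  have hD2 : D₂ ≤ D := le_trans (le_trans (le_max_right _ _) (le_max_left _ _)) hD
  have hD3 : D₃ ≤ D := le_trans (le_max_right _ _) hD
  have hℓbig := hD₃ D hD3
  have hℓ3 : 3 ≤ ell D := le_trans (le_max_left _ _) hℓbig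
  have hℓY : KY + 1 ≤ ell D := le_trans (le_trans (le_max_left _ _) (le_max_right _ _)) hℓbig
  have hℓK : K / ε + 1 ≤ ell D := le_trans (le_trans (le_max_right _ _) (le_max_right _ _)) hℓbig
  have hℓ1 : 1 ≤ ell D := by linarith
  have hℓ0 : 0 < ell D := by linarith
  have hlog1 : 1 ≤ Real.log D := by rw [← ell]; exact hℓ1
  -- M1 with the nonnegative constant
  have hM1 : ∀ q₁ m₂ : ℕ, 1 ≤ q₁ → 1 ≤ m₂ →
      (∑' m₁ : ℕ, ‖bcoef D (q₁ * m₁)‖ * ‖kappa2bar c' D (m₁ * m₂)‖ / (m₁ : ℝ)) ≤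
        CM * (q₁.divisors.card : ℝ) * ‖kappa2bar c' D m₂‖ * ((m₂ : ℝ) / m₂.totient) ^ 2 := by
    intro q₁ m₂ hq₁ hm₂
    refine (hD₂ D χ hD2 hq hp q₁ m₂ hq₁ hm₂).trans ?_
    have : 0 ≤ (q₁.divisors.card : ℝ) * ‖kappa2bar c' D m₂‖ * ((m₂ : ℝ) / m₂.totient) ^ 2 := by positivity
    calc CM₀ * (q₁.divisors.card : ℝ) * ‖kappa2bar c' D m₂‖ * ((m₂ : ℝ) / m₂.totient) ^ 2
        = CM₀ * ((q₁.divisors.card : ℝ) * ‖kappa2bar c' D m₂‖ * ((m₂ : ℝ) / m₂.totient) ^ 2) := by ring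
      _ ≤ CM * ((q₁.divisors.card : ℝ) * ‖kappa2bar c' D m₂‖ * ((m₂ : ℝ) / m₂.totient) ^ 2) :=
          mul_le_mul_of_nonneg_right hCMge this
      _ = _ := by ring
  -- the count with the nonnegative constant
  have hA0 : 0 ≤ frakA χ := frakA_nonneg χ
  have hcnt : ∑ l ∈ Finset.Ico 1 (D ^ 4), ‖nu χ l‖ * tau 6 l / l ≤ CA' * (frakA χ + 1) ^ 3 := by
    refine (hD₁ D χ hD1 hq hp hA).trans ?_
    have hA1 : 0 ≤ (frakA χ + 1) ^ 3 := by positivity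
    exact mul_le_mul_of_nonneg_right hCAge hA1
  -- sizes
  have hα : alpha D = π / ell D ^ 9 := by rw [alpha, bigP, Real.log_exp]
  have hb : |b1 c' D| ≤ Kb / ell D ^ 9 := by
    have := U007.abs_b1_le c' hlog1
    rw [hα] at this
    calc |b1 c' D| ≤ (1 + 5 * |c'| * π) * (π / ell D ^ 9) := this
      _ = Kb / ell D ^ 9 := by rw [hKb]; ring
  have hN2 : Real.log (⌈4 * ((D : ℝ) ^ 4 + 1) * bigT D ^ 4⌉₊ : ℕ) + Real.log 4 ≤ 13 * ell D ^ 2 :=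
    log_N2_add_log_four_le (D := D) hℓ1
  -- `Y = KY / 𝓛⁷ ≤ 1`
  have hYeq : 4 * C4 * (Kb / ell D ^ 9) * (13 * ell D ^ 2) = KY / ell D ^ 7 := by
    have h97 : ell D ^ 9 = ell D ^ 7 * ell D ^ 2 := by ring
    rw [hKY, h97]; field_simp
  have hℓ7 : ell D ≤ ell D ^ 7 := le_self_pow₀ hℓ1 (by norm_num)
  have hY0 : 0 ≤ KY / ell D ^ 7 := by positivity
  have hY1 : KY / ell D ^ 7 ≤ 1 := by
    rw [div_le_one (by positivity)]; linarith
  -- `Y (e^Y − 1) ≤ 2 Y² ≤ 2 KY² / 𝓛⁹`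
  have hOm : (KY / ell D ^ 7) * (Real.exp (KY / ell D ^ 7) - 1) ≤ 2 * KY ^ 2 / ell D ^ 9 := by
    refine (mul_exp_sub_one_le hY0 hY1).trans ?_
    have h4 : (KY / ell D ^ 7) ^ 2 ≤ KY ^ 2 / ell D ^ 9 := by
      rw [div_pow, ← pow_mul]
      refine div_le_div_of_nonneg_left (sq_nonneg _) (by positivity) ?_
      exact pow_le_pow_right₀ hℓ1 (by norm_num)
    calc 2 * (KY / ell D ^ 7) ^ 2 ≤ 2 * (KY ^ 2 / ell D ^ 9) := by linarith
      _ = 2 * KY ^ 2 / ell D ^ 9 := by ring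
  -- the prime-power part `≤ KP / 𝓛⁹`
  have hPi : 8 * C4' * C5 * (Kb / ell D ^ 9) = KP / ell D ^ 9 := by rw [hKP]; ring
  have hW : (4 * C4 * (Kb / ell D ^ 9) * (13 * ell D ^ 2)) *
        (Real.exp (4 * C4 * (Kb / ell D ^ 9) * (13 * ell D ^ 2)) - 1) +
      8 * C4' * C5 * (Kb / ell D ^ 9) ≤ (2 * KY ^ 2 + KP) / ell D ^ 9 := by
    rw [hYeq, hPi, add_div]; exact add_le_add hOm le_rfl
  have hW0 : 0 ≤ (4 * C4 * (Kb / ell D ^ 9) * (13 * ell D ^ 2)) *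
        (Real.exp (4 * C4 * (Kb / ell D ^ 9) * (13 * ell D ^ 2)) - 1) +
      8 * C4' * C5 * (Kb / ell D ^ 9) := by
    rw [hYeq, hPi]
    exact add_nonneg (mul_nonneg hY0 (by have := Real.one_le_exp hY0; linarith))
      (div_nonneg hKP0 (by positivity))
  -- `𝔞 + 1 ≤ KA 𝓛⁴`
  have hA4 : frakA χ + 1 ≤ KA * ell D ^ 4 := by
    have h := frakA_le_ell_pow_four' χ hℓ3 hp
    have h1 : (1 : ℝ) ≤ ell D ^ 4 := one_le_pow₀ hℓ1
    have e : KA * ell D ^ 4 = 16 * Real.exp 9 * ell D ^ 4 + ell D ^ 4 := by rw [hKA]; ring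
    rw [e]; linarith
  have hcount' : ∑ l ∈ Finset.Ico 1 (D ^ 4), ‖nu χ l‖ * tau 6 l / l ≤ CA' * (KA ^ 2 * ell D ^ 8) * (frakA χ + 1) := by
    refine hcnt.trans ?_
    have h3 : (frakA χ + 1) ^ 3 = (frakA χ + 1) ^ 2 * (frakA χ + 1) := by ring
    have h2 : (frakA χ + 1) ^ 2 ≤ (KA * ell D ^ 4) ^ 2 := pow_le_pow_left₀ (by linarith) hA4 2
    rw [h3, mul_assoc]
    refine mul_le_mul_of_nonneg_left ?_ hCA'0
    calc (frakA χ + 1) ^ 2 * (frakA χ + 1) ≤ (KA * ell D ^ 4) ^ 2 * (frakA χ + 1) :=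
          mul_le_mul_of_nonneg_right h2 (by linarith)
      _ = KA ^ 2 * ell D ^ 8 * (frakA χ + 1) := by ring
  have hS0 : 0 ≤ ∑ l ∈ Finset.Ico 1 (D ^ 4), ‖nu χ l‖ * tau 6 l / l :=
    Finset.sum_nonneg fun l _ => div_nonneg (mul_nonneg (norm_nonneg _) (tau_nonneg 6 l)) (Nat.cast_nonneg l)
  have heq : CM * ((2 * KY ^ 2 + KP) / ell D ^ 9) * (CA' * (KA ^ 2 * ell D ^ 8) * (frakA χ + 1)) =
      (K / ell D) * (frakA χ + 1) := by
    rw [hK]; field_simp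
  have hfin : K / ell D ≤ ε := by
    rw [div_le_iff₀ hℓ0]
    have : K / ε ≤ ell D := by linarith
    rw [div_le_iff₀ hε] at this
    linarith
  -- the deterministic bound (introduced last: it is a large term, kept away from `linarith`)
  have hmain := outer_composite_le c' χ hℓ3 hCM0 hM1 hC4 hC4' hC5 hb hN2
    (fun a b m => (D : ℝ) ^ 4 < b * m ∧ 2 ≤ m ∧ ¬ m.Prime ∧ Nat.Coprime m a)
    (fun a b m h => ⟨h.2.1, h.2.2.1⟩)
  refine hmain.trans ?_
  calc CM * ((4 * C4 * (Kb / ell D ^ 9) * (13 * ell D ^ 2)) *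
          (Real.exp (4 * C4 * (Kb / ell D ^ 9) * (13 * ell D ^ 2)) - 1) + 8 * C4' * C5 * (Kb / ell D ^ 9)) *
          ∑ l ∈ Finset.Ico 1 (D ^ 4), ‖nu χ l‖ * tau 6 l / l
      ≤ CM * ((2 * KY ^ 2 + KP) / ell D ^ 9) * (CA' * (KA ^ 2 * ell D ^ 8) * (frakA χ + 1)) :=
        mul_le_mul (mul_le_mul_of_nonneg_left hW hCM0) hcount' hS0
          (mul_nonneg hCM0 (div_nonneg (by positivity) (by positivity)))
    _ = (K / ell D) * (frakA χ + 1) := heq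
    _ ≤ ε * (frakA χ + 1) := mul_le_mul_of_nonneg_right hfin (by linarith)

end Outer

end Literature.NumberTheory.LFunctions.Zhang2022.Typed.Section17
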